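import Summits.CriticalPhenomena.PercolationContinuityZ3.Theses.PercAnnulusCrossing
import Summits.CriticalPhenomena.PercolationContinuityZ3.Theorems.PercTorusSliceFillingSliceFillingTransport
import Summits.CriticalPhenomena.PercolationContinuityZ3.Theorems.PercTorusSliceFillingTorusNonProliferationBKEventual
import Literature.Probability.Percolation.InequalitiesProofs
import HarnessLib

/-!
# `TorusNonProliferation` from `CritAnnulusNonCrossing` (route `PercTorusSliceFilling`, crux
# stmt-CriticalPhenomena-5415; bridge to crux stmt-CriticalPhenomena-0846 of route
# `PercAnnulusCrossing`)

Support file (`--supports stmt-CriticalPhenomena-5415`) written by the line lead (c3) of the crux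
`TorusNonProliferation` (tightness of the number `N_sf(T_n)` of slice-filling open clusters of
the critical 3-torus `T_n = (ℤ/nℤ)³`; a cluster `S` is *slice-filling* (sf) iff
`∃ i, ∀ t : ZMod n, ∃ y ∈ S, y i = t`).

Main result: `torusNonProliferation_of_critAnnulusNonCrossing` —

  `PercAnnulusCrossing.CritAnnulusNonCrossing → PercTorusSliceFilling.TorusNonProliferation`,

i.e. item stmt-CriticalPhenomena-5415 closes the moment item stmt-CriticalPhenomena-0846 (X_B:
at `p_c(ℤ³)`, uniformly in `m ≥ 1`, with probability `≥ c` there is no open path inside `B(2m)`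
from `B(m)` to `∂ⁱⁿB(2m)`) does. The proof is a same-`p`, finite-range argument:

* `locArm_of_sliceFilling_base` — POINTWISE, below the wrapping scale (`2M + 2 ≤ n`, only torus
  edges open): if the cluster of `x + proj a₀`, `a₀ ∈ B(M)`, is slice-filling, then in the
  configuration lifted along the chart `a ↦ x + proj a` of `B(M)` (chart file
  `PercTorusSliceFillingSliceFillingTransportChart.lean`) the vertex `a₀` is joined inside `B(M)`
  to an inner-boundary vertex of `B(M)` (otherwise the chart image of the lifted cluster is closed
  under open torus edges and sees at most `2M + 1 < n` slices) — the base-point version of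
  `SliceFillingTransportProof.locArm_of_sliceFilling`.
* `real_sfNear_le_annulusCrossing` — hence, by the identity of local laws
  (`map_restrictConfig_chart_eq`), for `4m + 2 ≤ n` and every centre `x`,
  `P_{T_n,p}(some C(x + proj a), a ∈ B(m), is sf) ≤ P_{ℤ³,p}(B(m) ↔ ∂ⁱⁿB(2m) inside B(2m))`.
* `noSliceFilling_pos_of_critAnnulusNonCrossing` — for `n ≥ 6` put `m = ⌊(n-2)/4⌋`; the 27
  projected boxes `x_j + proj B(m)`, `x_j = ((2m+1) j + m) mod n`, `j ∈ {0,1,2}³`, cover `T_n`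
  (`n ≤ 4m + 5 ≤ 3(2m+1)`), the 27 events "no sf cluster through `x_j + proj B(m)`" are
  decreasing, so by Harris–FKG (`harris_fkg_lower`, iterated) and X_B,
  `P_{T_n,p_c}(no sf cluster) ≥ c^27`.
* the landed BK reduction in its asymptotic form
  (`torusNonProliferation_of_noSliceFilling_eventually_pos`, van den Berg–Kesten geometric tail)
  turns this positive liminf into tightness of `N_sf`.

Remark (for the planner). X_B implies `θ(p_c) = 0` directly (assembly of route
`PercAnnulusCrossing`, landed), so this bridge does not shorten the route; it records that the BK
branch of line `birth` (`stub_noSliceFillingPos`) is implied by the existing crux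
stmt-CriticalPhenomena-0846, exactly as `ThinClusterTransport` records that the crux is implied by
stmt-CriticalPhenomena-5414. Pure proof file: no definitions, every statement over existing
declarations.
-/

noncomputable section

namespace Summit.CriticalPhenomena.PercolationContinuityZ3.Theorems

open MeasureTheory ProbabilityTheory
open Literature.Probability.Percolation Literature.Probability.LatticeModels
open Summit.CriticalPhenomena.PercolationContinuityZ3.Theses
open scoped Classical

namespace PercTorusSliceFillingTorusNonProliferationAnnulus

open SliceFillingTransportProof

variable {n M : ℕ}

/-! ## Pointwise: a slice-filling cluster through the chart exits the box -/

/-- **Local arm from a base point** (only torus edges open, `2M + 2 ≤ n`): if the open cluster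
of `x + proj a₀`, `a₀ ∈ B(M)`, meets every slice in some direction, then in the configuration
lifted along the chart of `B(M)` at `x` the vertex `a₀` is joined to an inner-boundary vertex of
`B(M)`. (Otherwise the chart image of the lifted cluster of `a₀` is closed under open torus edges,
`exists_lift_of_adj`, hence contains the whole cluster, which then sees at most `2M + 1 < n`
residues in every coordinate.) [folklore] -/
theorem locArm_of_sliceFilling_base (hn : 2 * M + 2 ≤ n) [NeZero n] (x : TorusSite 3 n)
    {ω : BondConfig (TorusSite 3 n)} (hω : ω ⊆ (torusGraph 3 n).edgeSet)
    (a₀ : (box 3 M : Set (Site 3)))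
    (hsf : ∃ i : Fin 3, ∀ t : ZMod n,
      ∃ y ∈ openCluster ω (x + Torus.proj n (a₀ : Site 3)), y i = t) :
    ∃ b : (box 3 M : Set (Site 3)), (b : Site 3) ∈ innerBoundary (zdGraph 3) (box 3 M) ∧
      (openGraph (restrictConfig
        (fun a : (box 3 M : Set (Site 3)) => x + Torus.proj n (a : Site 3)) ω)).Reachable a₀ b := by
  by_contra harm
  push Not at harm
  set η := restrictConfig (fun a : (box 3 M : Set (Site 3)) => x + Torus.proj n (a : Site 3)) ω
    with hη
  -- the chart image of the lifted cluster of `a₀` contains `C(x + proj a₀)`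
  have hsub : openCluster ω (x + Torus.proj n (a₀ : Site 3)) ⊆
      (fun a : (box 3 M : Set (Site 3)) => x + Torus.proj n (a : Site 3)) ''
        {a | (openGraph η).Reachable a₀ a} := by
    intro v hv
    change (openGraph ω).Reachable (x + Torus.proj n (a₀ : Site 3)) v at hv
    rw [SimpleGraph.reachable_iff_reflTransGen] at hv
    induction hv with
    | refl => exact ⟨a₀, SimpleGraph.Reachable.refl _, rfl⟩
    | tail _ hbc ih =>
      obtain ⟨a, ha, rfl⟩ := ih
      have hain : (a : Site 3) ∉ innerBoundary (zdGraph 3) (box 3 M) := fun hin => harm a hin ha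
      obtain ⟨b, hb, hab⟩ := exists_lift_of_adj x hω hain hbc
      exact ⟨b, SimpleGraph.Reachable.trans ha hab.reachable, hb⟩
  obtain ⟨i, hi⟩ := hsf
  -- every residue is `x i + k (mod n)` for some `k ∈ [-M, M]`: too few residues
  have hcover : (Finset.univ : Finset (ZMod n)) ⊆
      (Finset.Icc (-(M : ℤ)) M).image fun k : ℤ => x i + (k : ZMod n) := by
    intro t _
    obtain ⟨y, hy, hyt⟩ := hi t
    obtain ⟨a, -, rfl⟩ := hsub hy
    refine Finset.mem_image.2 ⟨(a : Site 3) i, ?_, ?_⟩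
    · have := a.2
      rw [Finset.mem_coe, mem_box] at this
      exact Finset.mem_Icc.2 (this i)
    · rw [← hyt]; simp [Torus.proj_apply]
  have hcard := Finset.card_le_card hcover
  rw [Finset.card_univ, ZMod.card] at hcard
  have h2 := hcard.trans Finset.card_image_le
  rw [Int.card_Icc] at h2
  omega

/-! ## The local event and the two sides of the chart -/

/-- **Torus side.** If only torus edges are open, `4`-fold room `2M + 2 ≤ n`, `m ≤ M`: a
slice-filling cluster through the projected box `x + proj B(m)` gives, in the lifted
configuration on `B(M)`, an open path inside `B(M)` from `B(m)` to `∂ⁱⁿB(M)`. [folklore] -/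
theorem sfNear_subset_preimage (hn : 2 * M + 2 ≤ n) [NeZero n] (x : TorusSite 3 n) {m : ℕ}
    (hm : m ≤ M) :
    {ω : BondConfig (TorusSite 3 n) | ∃ a ∈ (box 3 m : Set (Site 3)), ∃ i : Fin 3, ∀ t : ZMod n,
        ∃ y ∈ openCluster ω (x + Torus.proj n a), y i = t} ∩
        {ω | ω ⊆ (torusGraph 3 n).edgeSet} ⊆
      restrictConfig (fun a : (box 3 M : Set (Site 3)) => x + Torus.proj n (a : Site 3)) ⁻¹'
        {η | ∃ a : (box 3 M : Set (Site 3)), (a : Site 3) ∈ (box 3 m : Set (Site 3)) ∧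
          ∃ b : (box 3 M : Set (Site 3)), (b : Site 3) ∈ innerBoundary (zdGraph 3) (box 3 M) ∧
            (openGraph η).Reachable a b} := by
  rintro ω ⟨⟨a, ha, hsf⟩, hω⟩
  have haM : a ∈ (box 3 M : Set (Site 3)) :=
    Finset.mem_coe.2 (box_mono 3 hm (Finset.mem_coe.1 ha))
  obtain ⟨b, hb, hr⟩ := locArm_of_sliceFilling_base hn x hω ⟨a, haM⟩ hsf
  exact ⟨⟨a, haM⟩, ha, b, hb, hr⟩

/-- **`ℤ³` side.** The local event pulled back along the restriction to `B(M)` is contained in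
the annulus-crossing event `{B(m) ↔ ∂ⁱⁿB(M) inside B(M)}` of `ℤ³` (`induce_openGraph_eq`).
[folklore] -/
theorem preimage_subset_annulusCrossing (m M : ℕ) :
    restrictConfig (Subtype.val : (box 3 M : Set (Site 3)) → Site 3) ⁻¹'
        {η | ∃ a : (box 3 M : Set (Site 3)), (a : Site 3) ∈ (box 3 m : Set (Site 3)) ∧
          ∃ b : (box 3 M : Set (Site 3)), (b : Site 3) ∈ innerBoundary (zdGraph 3) (box 3 M) ∧
            (openGraph η).Reachable a b} ⊆
      {ω : BondConfig (Site 3) | ∃ a ∈ box 3 m, ∃ y ∈ innerBoundary (zdGraph 3) (box 3 M),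
        ω ∈ openConnIn ↑(box 3 M) a y} := by
  rintro ω ⟨a, ha, b, hb, hr⟩
  refine ⟨a, Finset.mem_coe.1 ha, b, hb, a.2, b.2, ?_⟩
  rw [induce_openGraph_eq]
  simpa using hr

/-- **Transfer.** For every `p`, `4m + 2 ≤ n` and every centre `x ∈ T_n`:
`P_{T_n,p}(some C(x + proj a), a ∈ B(m), is slice-filling) ≤ P_{ℤ³,p}(B(m) ↔ ∂ⁱⁿB(2m) in B(2m))`
(same local law of the chart of `B(2m)`, `map_restrictConfig_chart_eq`). [folklore] -/
theorem real_sfNear_le_annulusCrossing (p : unitInterval) {n m : ℕ} (hn : 4 * m + 2 ≤ n)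
    (x : TorusSite 3 n) :
    (bondPercolation (torusGraph 3 n) p).real {ω | ∃ a ∈ (box 3 m : Set (Site 3)), ∃ i : Fin 3,
        ∀ t : ZMod n, ∃ y ∈ openCluster ω (x + Torus.proj n a), y i = t} ≤
      (bondPercolation (zdGraph 3) p).real {ω | ∃ a ∈ box 3 m,
        ∃ y ∈ innerBoundary (zdGraph 3) (box 3 (2 * m)), ω ∈ openConnIn ↑(box 3 (2 * m)) a y} := by
  haveI : NeZero n := ⟨by omega⟩
  have hn' : 2 * (2 * m) + 2 ≤ n := by omega
  set μT := bondPercolation (torusGraph 3 n) p with hμT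
  set μZ := bondPercolation (zdGraph 3) p with hμZ
  set S : Set (BondConfig (TorusSite 3 n)) := {ω | ∃ a ∈ (box 3 m : Set (Site 3)), ∃ i : Fin 3,
      ∀ t : ZMod n, ∃ y ∈ openCluster ω (x + Torus.proj n a), y i = t} with hS
  set B : Set (BondConfig (box 3 (2 * m) : Set (Site 3))) :=
    {η | ∃ a : (box 3 (2 * m) : Set (Site 3)), (a : Site 3) ∈ (box 3 m : Set (Site 3)) ∧
      ∃ b : (box 3 (2 * m) : Set (Site 3)), (b : Site 3) ∈ innerBoundary (zdGraph 3) (box 3 (2 * m)) ∧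
        (openGraph η).Reachable a b} with hB
  -- almost surely only torus edges are open
  have hnullT : μT.real {ω : BondConfig (TorusSite 3 n) | ¬ ω ⊆ (torusGraph 3 n).edgeSet} = 0 := by
    have h := setBernoulli_ae_subset (u := (torusGraph 3 n).edgeSet) (p := p)
    rw [measureReal_eq_zero_iff]
    exact ae_iff.1 h
  have hcover : S ∩ {ω | ω ⊆ (torusGraph 3 n).edgeSet} ⊆
      restrictConfig (fun a : (box 3 (2 * m) : Set (Site 3)) => x + Torus.proj n (a : Site 3)) ⁻¹' B :=
    sfNear_subset_preimage hn' x (by omega)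
  have htransfer :
      μT.real (restrictConfig
          (fun a : (box 3 (2 * m) : Set (Site 3)) => x + Torus.proj n (a : Site 3)) ⁻¹' B) =
        μZ.real (restrictConfig (Subtype.val : (box 3 (2 * m) : Set (Site 3)) → Site 3) ⁻¹' B) := by
    rw [← map_measureReal_apply (measurable_restrictConfig _) MeasurableSet.of_discrete,
      ← map_measureReal_apply (measurable_restrictConfig _) MeasurableSet.of_discrete,
      hμT, hμZ, map_restrictConfig_chart_eq hn' x p]
  have hZ : restrictConfig (Subtype.val : (box 3 (2 * m) : Set (Site 3)) → Site 3) ⁻¹' B ⊆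
      {ω : BondConfig (Site 3) | ∃ a ∈ box 3 m, ∃ y ∈ innerBoundary (zdGraph 3) (box 3 (2 * m)),
        ω ∈ openConnIn ↑(box 3 (2 * m)) a y} :=
    preimage_subset_annulusCrossing m (2 * m)
  calc μT.real S
      ≤ μT.real (S ∩ {ω | ω ⊆ (torusGraph 3 n).edgeSet} ∪
          {ω | ¬ ω ⊆ (torusGraph 3 n).edgeSet}) :=
        measureReal_mono (fun ω hω => by
          by_cases h : ω ⊆ (torusGraph 3 n).edgeSet
          · exact Or.inl ⟨hω, h⟩
          · exact Or.inr h)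
    _ ≤ μT.real (S ∩ {ω | ω ⊆ (torusGraph 3 n).edgeSet}) +
          μT.real {ω | ¬ ω ⊆ (torusGraph 3 n).edgeSet} := measureReal_union_le _ _
    _ = μT.real (S ∩ {ω | ω ⊆ (torusGraph 3 n).edgeSet}) := by rw [hnullT, add_zero]
    _ ≤ μT.real (restrictConfig
          (fun a : (box 3 (2 * m) : Set (Site 3)) => x + Torus.proj n (a : Site 3)) ⁻¹' B) :=
        measureReal_mono hcover
    _ = μZ.real (restrictConfig (Subtype.val : (box 3 (2 * m) : Set (Site 3)) → Site 3) ⁻¹' B) :=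
        htransfer
    _ ≤ _ := measureReal_mono hZ

/-! ## Harris–FKG over finitely many decreasing events; the 27 centres -/

/-- Iterated Harris–FKG on the finite torus: for decreasing events `D j`,
`∏_{j ∈ s} P(D j) ≤ P(⋂_{j ∈ s} D j)` (Grimmett 1999, Thm. (2.4) and (2.7); every event of the
finite configuration space is measurable). [folklore] -/
theorem prod_real_le_real_biInter {ι : Type*} (p : unitInterval) (n : ℕ) [NeZero n]
    (D : ι → Set (BondConfig (TorusSite 3 n))) (hD : ∀ j, IsLowerSet (D j)) (s : Finset ι) :
    ∏ j ∈ s, (bondPercolation (torusGraph 3 n) p).real (D j) ≤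
      (bondPercolation (torusGraph 3 n) p).real (⋂ j ∈ s, D j) := by
  induction s using Finset.induction_on with
  | empty => simp
  | insert a s ha ih =>
    rw [Finset.prod_insert ha, Finset.set_biInter_insert]
    calc (bondPercolation (torusGraph 3 n) p).real (D a) *
          ∏ j ∈ s, (bondPercolation (torusGraph 3 n) p).real (D j)
        ≤ (bondPercolation (torusGraph 3 n) p).real (D a) *
            (bondPercolation (torusGraph 3 n) p).real (⋂ j ∈ s, D j) :=
          mul_le_mul_of_nonneg_left ih measureReal_nonneg
      _ ≤ (bondPercolation (torusGraph 3 n) p).real (D a ∩ ⋂ j ∈ s, D j) :=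
          harris_fkg_lower (torusGraph 3 n) p (hD a) (isLowerSet_iInter₂ fun j _ => hD j)
            (Set.toFinite _).measurableSet (Set.toFinite _).measurableSet

/-- **The 27 projected boxes cover the torus.** For `n ≤ 3(2m+1)` (and `n ≠ 0`) every vertex
`v ∈ T_n` is `x_j + proj a` for some `j ∈ {0,1,2}³` and `a ∈ B(m)`, where
`x_j i = (2m+1) jᵢ + m (mod n)`. [folklore] -/
theorem exists_centre (n m : ℕ) [NeZero n] (hn : n ≤ 3 * (2 * m + 1)) (v : TorusSite 3 n) :
    ∃ j : Fin 3 → Fin 3, ∃ a ∈ (box 3 m : Set (Site 3)),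
      v = (fun i => (((2 * m + 1) * (j i : ℕ) + m : ℕ) : ZMod n)) + Torus.proj n a := by
  have hq : ∀ i : Fin 3, (v i).val / (2 * m + 1) < 3 := fun i =>
    Nat.div_lt_of_lt_mul ((ZMod.val_lt (v i)).trans_le (by linarith))
  refine ⟨fun i => ⟨(v i).val / (2 * m + 1), hq i⟩,
    fun i => (((v i).val % (2 * m + 1) : ℕ) : ℤ) - m, ?_, ?_⟩
  · rw [Finset.mem_coe, mem_box]
    intro i
    have hr : (v i).val % (2 * m + 1) < 2 * m + 1 := Nat.mod_lt _ (by omega)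
    constructor <;> omega
  · funext i
    have key : ((2 * m + 1) * ((v i).val / (2 * m + 1)) + (v i).val % (2 * m + 1) : ℕ) =
        (v i).val := Nat.div_add_mod _ _
    simp only [Pi.add_apply, Torus.proj_apply]
    calc v i = (((v i).val : ℕ) : ZMod n) := (ZMod.natCast_zmod_val (v i)).symm
      _ = (((2 * m + 1) * ((v i).val / (2 * m + 1)) + (v i).val % (2 * m + 1) : ℕ) : ZMod n) := by
          rw [key]
      _ = _ := by
          simp only [Nat.cast_add, Nat.cast_mul, Nat.cast_ofNat, Nat.cast_one, Int.cast_sub,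
            Int.cast_natCast]
          ring

/-- Slice-filling of the cluster through a fixed vertex is an increasing event, so "no
slice-filling cluster through the projected box `x + proj B(m)`" is decreasing. [folklore] -/
theorem isLowerSet_noSfNear (n m : ℕ) (x : TorusSite 3 n) : IsLowerSet
    {ω : BondConfig (TorusSite 3 n) | ∀ a ∈ (box 3 m : Set (Site 3)), ¬ ∃ i : Fin 3, ∀ t : ZMod n,
      ∃ y ∈ openCluster ω (x + Torus.proj n a), y i = t} := by
  intro ω ω' hle hω a ha ⟨i, hi⟩
  refine hω a ha ⟨i, fun t => ?_⟩
  obtain ⟨y, hy, hyt⟩ := hi t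
  exact ⟨y, SimpleGraph.Reachable.mono (openGraph_mono hle) hy, hyt⟩

end PercTorusSliceFillingTorusNonProliferationAnnulus

open PercTorusSliceFillingTorusNonProliferationAnnulus

/-- **X_B ⟹ the critical 3-torus has no slice-filling cluster with probability bounded away
from zero (eventually in `n`).** If `CritAnnulusNonCrossing` (item stmt-CriticalPhenomena-0846 of
route `PercAnnulusCrossing`: `P_{p_c}(B(m) ↔ ∂ⁱⁿB(2m) in B(2m)) ≤ 1 - c` for all `m ≥ 1`) holds,
then for every `n ≥ 6`, `P_{T_n,p_c}(no open cluster of T_n is slice-filling) ≥ c^27`: with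
`m = ⌊(n-2)/4⌋` the 27 projected boxes `x_j + proj B(m)` cover `T_n` (`exists_centre`), a
slice-filling cluster through `x_j + proj B(m)` forces the annulus crossing in the chart of
`B(2m)` at `x_j` (`real_sfNear_le_annulusCrossing`), and the 27 decreasing events are
positively correlated (`prod_real_le_real_biInter`). [folklore] -/
theorem noSliceFilling_eventually_pos_of_critAnnulusNonCrossing
    (h : PercAnnulusCrossing.CritAnnulusNonCrossing) :
    ∃ c : ℝ, 0 < c ∧ ∃ N : ℕ, ∀ n : ℕ, N ≤ n →
      c ≤ (bondPercolation (torusGraph 3 n) (criticalProbI 3)).real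
        {ω | ∀ x : TorusSite 3 n, ¬ ∃ i : Fin 3, ∀ t : ZMod n, ∃ y ∈ openCluster ω x, y i = t} := by
  obtain ⟨c, hc, hcn⟩ := h
  refine ⟨c ^ 27, pow_pos hc 27, 6, fun n hn => ?_⟩
  haveI : NeZero n := ⟨by omega⟩
  -- the scale `m = ⌊(n-2)/4⌋ ≥ 1`: `4m + 2 ≤ n ≤ 4m + 5 ≤ 3(2m+1)`
  set m : ℕ := (n - 2) / 4 with hm
  have hm1 : 1 ≤ m := by omega
  have hmn : 4 * m + 2 ≤ n := by omega
  have hnm : n ≤ 3 * (2 * m + 1) := by omega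
  set μ := bondPercolation (torusGraph 3 n) (criticalProbI 3) with hμ
  -- the 27 centres and the decreasing events "no sf cluster through the `j`-th projected box"
  set ctr : (Fin 3 → Fin 3) → TorusSite 3 n :=
    fun j i => (((2 * m + 1) * (j i : ℕ) + m : ℕ) : ZMod n) with hctr
  set D : (Fin 3 → Fin 3) → Set (BondConfig (TorusSite 3 n)) := fun j =>
    {ω | ∀ a ∈ (box 3 m : Set (Site 3)), ¬ ∃ i : Fin 3, ∀ t : ZMod n,
      ∃ y ∈ openCluster ω (ctr j + Torus.proj n a), y i = t} with hD
  -- each has probability at least `c`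
  have hDc : ∀ j, c ≤ μ.real (D j) := by
    intro j
    set S : Set (BondConfig (TorusSite 3 n)) := {ω | ∃ a ∈ (box 3 m : Set (Site 3)), ∃ i : Fin 3,
        ∀ t : ZMod n, ∃ y ∈ openCluster ω (ctr j + Torus.proj n a), y i = t} with hS
    have hDS : D j = Sᶜ := by
      ext ω
      simp only [hD, hS, Set.mem_setOf_eq, Set.mem_compl_iff, not_exists, not_and]
    have hSle : μ.real S ≤ 1 - c :=
      (real_sfNear_le_annulusCrossing (criticalProbI 3) hmn (ctr j)).trans (hcn m hm1)
    have hcompl : μ.real S + μ.real Sᶜ = 1 :=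
      probReal_add_probReal_compl (Set.toFinite _).measurableSet
    rw [hDS]
    linarith
  -- together they exclude every slice-filling cluster (the boxes cover the torus)
  have hsub : (⋂ j ∈ (Finset.univ : Finset (Fin 3 → Fin 3)), D j) ⊆
      {ω | ∀ x : TorusSite 3 n, ¬ ∃ i : Fin 3, ∀ t : ZMod n, ∃ y ∈ openCluster ω x, y i = t} := by
    intro ω hω v
    obtain ⟨j, a, ha, rfl⟩ := exists_centre n m hnm v
    have hωj : ω ∈ D j := Set.mem_iInter₂.1 hω j (Finset.mem_univ j)
    exact hωj a ha
  calc c ^ 27 = ∏ _j ∈ (Finset.univ : Finset (Fin 3 → Fin 3)), c := by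
        rw [Finset.prod_const, Finset.card_univ, Fintype.card_fun, Fintype.card_fin]; norm_num
    _ ≤ ∏ j ∈ (Finset.univ : Finset (Fin 3 → Fin 3)), μ.real (D j) :=
        Finset.prod_le_prod (fun _ _ => hc.le) fun j _ => hDc j
    _ ≤ μ.real (⋂ j ∈ (Finset.univ : Finset (Fin 3 → Fin 3)), D j) :=
        prod_real_le_real_biInter (criticalProbI 3) n D
          (fun j => isLowerSet_noSfNear n m (ctr j)) _
    _ ≤ _ := measureReal_mono hsub

/-- **`CritAnnulusNonCrossing ⟹ TorusNonProliferation`** (item stmt-CriticalPhenomena-0846 of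
route `PercAnnulusCrossing` implies the crux stmt-CriticalPhenomena-5415 of route
`PercTorusSliceFilling`): the positive liminf of `P_{T_n,p_c}(no sf cluster)` supplied by
`noSliceFilling_eventually_pos_of_critAnnulusNonCrossing` is turned into tightness of the number
of slice-filling clusters by the landed van den Berg–Kesten reduction
`torusNonProliferation_of_noSliceFilling_eventually_pos` (`P(N_sf ≥ k) ≤ P(N_sf ≥ 1)^k`).
[folklore] -/
theorem torusNonProliferation_of_critAnnulusNonCrossing :
    Summit.CriticalPhenomena.PercolationContinuityZ3.Theses.PercAnnulusCrossing.CritAnnulusNonCrossing →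
      Summit.CriticalPhenomena.PercolationContinuityZ3.Theses.PercTorusSliceFilling.TorusNonProliferation :=
  fun h => torusNonProliferation_of_noSliceFilling_eventually_pos
    (noSliceFilling_eventually_pos_of_critAnnulusNonCrossing h)

end Summit.CriticalPhenomena.PercolationContinuityZ3.Theorems

end
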